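import Literature.Computability.Cryptography.IndistinguishabilityObfuscatorSubexp
import Literature.Computability.Complexity.RandomizedProofs
import Literature.Computability.Cryptography.PseudorandomnessProofs
import Literature.Computability.Complexity.StringSwap
import Literature.Computability.Complexity.CodeFPArith
import HarnessLib

/-!
# Stub `stub_halfCoin` — coin halving preserves sub-exponential iO security
# (crux `WbwObfuscatedGluedTrees`, stmt-QuantumAdvantage-2340; line `knowledge-of-walk-split`, stage 4, lead c3)

Registered stub of the stage-4 skeleton `Cruxes/WbwObfuscatedGluedTrees/Lines/knowledge_of_walk_split.lean`
(target `…Generator.Residual.ResidualAudit`). For every obfuscator `O : CircuitObfuscator` and every bit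
sequence `b : ℕ → Bool`, the COIN-HALVING obfuscator
`⟨fun κ C r => O.obf κ C (r.take (|r| / 2)), fun m => 2 · O.coinLen m + b m⟩` (ask for `2c + b` coins, feed `O`
the first half) has the SAME obfuscation law (`obfPMF_halfCoin`: `U_{2c+b}` restricted to its first
`(2c+b)/2 = c` bits is `U_c`), hence the same functionality, slowdown and `(t,δ)`-security, and it is efficient
when `O` is (the preprocessing `⟨u, r⟩ ↦ ⟨u, r.take (|r|/2)⟩` is `mapSndFn` of an `FP` map obtained from the
typed calculus `CodeFP`; coin budget `≤ 2p + 1`). Twin of `Negative.CoinPad.isSubexpIO_padCoin`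
(`Negative/CoinPadding.lean`, one ignored extra coin). Generic; no crux content, no definitions.
-/

set_option linter.dupNamespace false

namespace Summit.QuantumAdvantage.QuantumAdvantage.Theorems.WbwObfuscatedGluedTrees.KnowledgeOfWalk.Residual

open Literature.Computability.Cryptography Literature.Computability.Complexity
open Literature.Computability.QuantumComplexity
open Filter Asymptotics

namespace HalfCoin

open Literature.Computability.Complexity.CodeFP (unE strE natE pairE)

variable (O : CircuitObfuscator) (b : ℕ → Bool)

/-! ### The obfuscation law -/

/-- `coins` of the coin-halving obfuscator: `2 · O.coins + b`. [folklore] -/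
theorem coins_halfCoin (κ : ℕ) {n : ℕ} (C : Circuit (Fin n)) :
    (⟨fun κ {_} C r => O.obf κ C (r.take (r.length / 2)), fun m => 2 * O.coinLen m + (b m).toNat⟩ :
        CircuitObfuscator).coins κ C =
      2 * O.coins κ C + (b (CircuitObfuscator.encodeInput (κ, ⟨n, C⟩)).length).toNat := rfl

/-- **`U_{2c+t}` restricted to its first half is `U_c`** (`(2c + t) / 2 = c` for a bit `t`). [folklore] -/
theorem uniformBits_map_take_half (c : ℕ) (t : Bool) :
    (uniformBits (2 * c + t.toNat)).map (fun r => r.take (r.length / 2)) = uniformBits c := by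
  rw [uniformBits, uniformBits, PMF.map_comp]
  have ht : t.toNat ≤ 1 := Bool.toNat_le t
  have hc : (2 * c + t.toNat) / 2 = c := by omega
  have h : ((fun r : List Bool => r.take (r.length / 2)) ∘ List.Vector.toList :
      List.Vector Bool (2 * c + t.toNat) → List Bool) = fun r => r.toList.take c := by
    funext r
    simp only [Function.comp_apply, List.Vector.toList_length, hc]
  rw [h]
  exact Literature.Computability.MetaComplexity.map_take_uniformOfFintype_vector (by omega)

/-- **Same obfuscation law.** [folklore] -/
theorem obfPMF_halfCoin (κ : ℕ) {n : ℕ} (C : Circuit (Fin n)) :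
    (⟨fun κ {_} C r => O.obf κ C (r.take (r.length / 2)), fun m => 2 * O.coinLen m + (b m).toNat⟩ :
        CircuitObfuscator).obfPMF κ C = O.obfPMF κ C := by
  unfold CircuitObfuscator.obfPMF
  rw [coins_halfCoin]
  show (uniformBits (2 * O.coins κ C + _)).map ((O.obf κ C) ∘ fun r => r.take (r.length / 2)) = _
  rw [← PMF.map_comp, uniformBits_map_take_half]

/-- Same law of the obfuscated CODE. [folklore] -/
theorem obfCodePMF_halfCoin (κ : ℕ) {n : ℕ} (C : Circuit (Fin n)) :
    (⟨fun κ {_} C r => O.obf κ C (r.take (r.length / 2)), fun m => 2 * O.coinLen m + (b m).toNat⟩ :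
        CircuitObfuscator).obfCodePMF κ C = O.obfCodePMF κ C := by
  unfold CircuitObfuscator.obfCodePMF
  rw [obfPMF_halfCoin]

/-- Same distinguishing advantages (with advice). [folklore] -/
theorem ioAdvantageAdv_halfCoin (D : RandAlg (List Bool) Bool) (a : ℕ → List Bool) (κ : ℕ) {n : ℕ}
    (C₀ C₁ : Circuit (Fin n)) :
    (⟨fun κ {_} C r => O.obf κ C (r.take (r.length / 2)), fun m => 2 * O.coinLen m + (b m).toNat⟩ :
        CircuitObfuscator).ioAdvantageAdv D a κ C₀ C₁ = O.ioAdvantageAdv D a κ C₀ C₁ := by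
  unfold CircuitObfuscator.ioAdvantageAdv
  rw [obfCodePMF_halfCoin, obfCodePMF_halfCoin]

/-! ### Functionality, slowdown, security -/

/-- Coin halving preserves perfect functionality. [folklore] -/
theorem preservesFunctionality_halfCoin {𝒞 : ℕ → Set SizedCircuit} (h : O.PreservesFunctionality 𝒞) :
    (⟨fun κ {_} C r => O.obf κ C (r.take (r.length / 2)), fun m => 2 * O.coinLen m + (b m).toNat⟩ :
      CircuitObfuscator).PreservesFunctionality 𝒞 := by
  intro κ n C hC C' hC'
  rw [obfPMF_halfCoin] at hC'
  exact h κ n C hC C' hC'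

/-- Coin halving preserves polynomial slowdown. [folklore] -/
theorem hasPolySlowdown_halfCoin {𝒞 : ℕ → Set SizedCircuit} (h : O.HasPolySlowdown 𝒞) :
    (⟨fun κ {_} C r => O.obf κ C (r.take (r.length / 2)), fun m => 2 * O.coinLen m + (b m).toNat⟩ :
      CircuitObfuscator).HasPolySlowdown 𝒞 := by
  obtain ⟨p, hp⟩ := h
  refine ⟨p, fun κ n C hC C' hC' => ?_⟩
  rw [obfPMF_halfCoin] at hC'
  exact hp κ n C hC C' hC'

/-- Coin halving preserves `(t,δ)`-indistinguishability. [folklore] -/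
theorem isSecureIndistinguishable_halfCoin {t δ : ℕ → ℝ} {𝒞 : ℕ → Set SizedCircuit}
    (h : O.IsSecureIndistinguishable t δ 𝒞) :
    (⟨fun κ {_} C r => O.obf κ C (r.take (r.length / 2)), fun m => 2 * O.coinLen m + (b m).toNat⟩ :
      CircuitObfuscator).IsSecureIndistinguishable t δ 𝒞 := by
  intro D hD a ha
  filter_upwards [h D hD a ha] with κ hκ n C₀ C₁ h₀ h₁ hs he
  rw [ioAdvantageAdv_halfCoin]
  exact hκ n C₀ C₁ h₀ h₁ hs he

/-! ### Efficiency -/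

/-- Half of the length of a string, in unary, is computed on codes (`CodeFP`: binary length, division by `2`,
capped binary-to-unary conversion with cap the length itself, `⌊|l|/2⌋ ≤ |l|`). [folklore] -/
theorem codeFP_halfLength : CodeFP strE unE (fun l : List Bool => l.length / 2) :=
  (CodeFP.unOfNatMin.comp (CodeFP.strLength.pair (CodeFP.natDiv.comp
    ((CodeFP.natOfUn.comp CodeFP.strLength).pair (CodeFP.const strE (2 : ℕ)))))).congr
    fun _ => min_eq_left (Nat.div_le_self _ _)

/-- **The halving map `l ↦ l ↾ ⌊|l|/2⌋` is in `FP`** (`strTake` after `codeFP_halfLength`; strings are their own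
codes). [folklore] -/
theorem takeHalf_mem_FP : (fun l : List Bool => l.take (l.length / 2)) ∈ FP := by
  obtain ⟨f, hf, hfg⟩ := CodeFP.strTake.comp (codeFP_halfLength.pair (CodeFP.id strE))
  have hf' : f = fun l : List Bool => l.take (l.length / 2) := funext fun l => hfg l
  rw [← hf']
  exact hf

/-- **The coin-halving obfuscator is efficient**: `O`'s machine after the polynomial-time preprocessing
`⟨u, r⟩ ↦ ⟨u, r ↾ ⌊|r|/2⌋⟩` (`mapSndFn` of `takeHalf_mem_FP`, transported along the input encoding;
`PolyTimeComputable.comp_holds`); coin budget bounded by `2p + 1`. [folklore] -/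
theorem isEfficient_halfCoin (h : O.IsEfficient) :
    (⟨fun κ {_} C r => O.obf κ C (r.take (r.length / 2)), fun m => 2 * O.coinLen m + (b m).toNat⟩ :
      CircuitObfuscator).IsEfficient := by
  obtain ⟨hrun, p, hp⟩ := h
  refine ⟨?_, 2 * p + 1, fun ℓ => ?_⟩
  · have hpre : PolyTimeComputable
        (fun pr : (ℕ × SizedCircuit) × List Bool => boolPair (CircuitObfuscator.encodeInput pr.1) pr.2)
        (fun pr : (ℕ × SizedCircuit) × List Bool => boolPair (CircuitObfuscator.encodeInput pr.1) pr.2)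
        (fun pr : (ℕ × SizedCircuit) × List Bool => (pr.1, pr.2.take (pr.2.length / 2))) :=
      PolyTimeComputable.of_encode_eq (f := mapSndFn fun l : List Bool => l.take (l.length / 2))
        (fun pr : (ℕ × SizedCircuit) × List Bool => boolPair (CircuitObfuscator.encodeInput pr.1) pr.2)
        (fun _ => rfl) (fun pr => by simp) (mapSndFn_mem_FP takeHalf_mem_FP)
    have hcomp := PolyTimeComputable.comp_holds hrun hpre
    have heq : (Function.uncurry O.toRandAlg.run) ∘
        (fun pr : (ℕ × SizedCircuit) × List Bool => (pr.1, pr.2.take (pr.2.length / 2))) =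
        Function.uncurry (⟨fun κ {_} C r => O.obf κ C (r.take (r.length / 2)),
          fun m => 2 * O.coinLen m + (b m).toNat⟩ : CircuitObfuscator).toRandAlg.run := by
      funext pr
      rfl
    rw [heq] at hcomp
    exact hcomp
  · show 2 * O.coinLen ℓ + (b ℓ).toNat ≤ (2 * p + 1).eval ℓ
    rw [Polynomial.eval_add, Polynomial.eval_mul, Polynomial.eval_one, Polynomial.eval_ofNat]
    have h₁ : O.coinLen ℓ ≤ p.eval ℓ := hp ℓ
    have h₂ : (b ℓ).toNat ≤ 1 := Bool.toNat_le _
    omega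

/-- **Coin halving preserves sub-exponential iO security** (any class, any `ε`, any extra-bit sequence).
[folklore] -/
theorem isSubexpIO_halfCoin {ε : ℝ} {𝒞 : ℕ → Set SizedCircuit} (h : IsSubexpIO ε 𝒞 O) :
    IsSubexpIO ε 𝒞 (⟨fun κ {_} C r => O.obf κ C (r.take (r.length / 2)),
      fun m => 2 * O.coinLen m + (b m).toNat⟩ : CircuitObfuscator) :=
  ⟨isEfficient_halfCoin O b h.isEfficient, preservesFunctionality_halfCoin O b h.preserves,
    hasPolySlowdown_halfCoin O b h.slowdown, isSecureIndistinguishable_halfCoin O b h.indist⟩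

end HalfCoin

/-- **Stub `stub_halfCoin` — coin halving preserves sub-exponential iO security** (any class, any `ε`, any
extra-bit sequence `b`): the obfuscator reading only the first half of its `2 · coinLen + b` coins has the SAME
obfuscation law (`U_{2c+b}` restricted to its first `c = (2c+b)/2` bits is `U_c`), hence the same functionality,
slowdown and `(t,δ)`-security, and it is efficient when `O` is (preprocessing `⟨u, r⟩ ↦ ⟨u, r.take (|r|/2)⟩` in
`FP`; coin budget `≤ 2p + 1`). Twin of `Negative.CoinPad.isSubexpIO_padCoin`. [folklore] -/
theorem stub_halfCoin :
    ∀ (ε : ℝ) (𝒞 : ℕ → Set SizedCircuit) (O : CircuitObfuscator) (b : ℕ → Bool), IsSubexpIO ε 𝒞 O →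
      IsSubexpIO ε 𝒞 (⟨fun κ {_} C r => O.obf κ C (r.take (r.length / 2)),
        fun m => 2 * O.coinLen m + (b m).toNat⟩ : CircuitObfuscator) := by
  intro ε 𝒞 O b h
  exact HalfCoin.isSubexpIO_halfCoin O b h

end Summit.QuantumAdvantage.QuantumAdvantage.Theorems.WbwObfuscatedGluedTrees.KnowledgeOfWalk.Residual
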